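/-
Copyright (c) 2026. All rights reserved.
Released under Apache 2.0 license as described in the file LICENSE.
-/
import Summits.HodgeConjecture.HodgeConjecture.Theorems.K2LiuArchMultiPlaceCompactPicture   -- ★ (G1-b) `finiteDimensional_span_reading` (+ ★ (G1-a) `exists_carrier_of_rightFinite`, ★ `Carrier`, `evalAt`)
import Summits.HodgeConjecture.HodgeConjecture.Theorems.K2LiuArchInducedTubeDefs            -- ★ (D∞) `IsArchSiegelSection`
import HarnessLib

/-!
# Crux `HLiu418`, G6-arch ASSEMBLY FILE 15 — (E8rec) DICTIONARY, brick (D-B): A ONE-PLACE SECTION READ THROUGH A TUBE FRAME IS A TUBE SIEGEL SECTION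
# WITH A COMPACT PICTURE IN `ℂ[u, D⁻¹]` — `∃ F Q, IsArchSiegelSection χ s F ∧ cp F = Q ∧ ∀ g, F (τ g) = b g`

Cell `hodgecm-mathlib`, crux item hLiu418 = `stmt-HodgeConjecture-24832` (helper lane `--supports`, count-neutral).  K2Liu-p11 (g4) (E8rec) dictionary (census
22:28Z, presentation head 22:37Z), brick (D-B); consumer: the presentation `exists_flat_tube_presentation` ⇒ K2Liu-p13 (g4)'s `hArch`.

WHAT.  ★ 2c-inst `K2LiuArchCompactPicturePlaceTensor.exists_sum_prod_archPlaces` splits a continuous `K_∞`-finite arch Siegel section over the complex places into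
one-place factors `b : H(L_w) → ℂ` — continuous, obeying the one-place Siegel law, finite under right translation by a compact `Kw w`.  ★ (E8) END
(`K2LiuArchBlockOfFrameEnd`, ★ FILE 10) integrates TUBE sections `F : M₄(ℂ) → ℂ` with `IsArchSiegelSection χ_k s F` and a compact picture `cp F = Q ∈ ℂ[u, D⁻¹]`
(★ S2-K `Carrier`, `evalAt`).  This file is the FRAME-GENERIC bridge: for a group `G` (⟵ `archLocal … w`), a multiplicative tube frame `τ : G →* M₄(ℂ)` onto `U(J)` and
injective (⟵ ★ `exists_tubeFrame_arch₄` (i)(vi) + frame injectivity; the membership clause (iii) is NOT needed), a reading frame `fr : U(2) →* G` with `τ (fr u) = κ(1,u)` (⟵ ★ `exists_readingFrame` + ★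
`tube_eq_of_chart_formula`), a function `b : G → ℂ` that is continuous, finite under the right `fr`-translates, and obeys the Siegel law IN TUBE LETTERS
(`b (p g) = χ(det (τp)₁₁)·‖det (τp)₁₁‖^{2s+2}·b g` whenever `(τ p)₂₁ = 0` ⟵ ★ F0P2-p08 `siegelDeltaCharacter_archPlace` ∕ `apply_update_tube_mul`):
* §1 `tubeAvatar`-free construction: **`exists_tubeSection_of_reading`** — `∃ F Q, IsArchSiegelSection χ s F ∧ (∀ v unitary, F (κ(1,v)) = ev_v Q) ∧ ∀ g, F (τ g) = b g`
  (`F :=` `b ∘ τ⁻¹` on `U(J)`, `0` off `U(J)`; the law off the image is `0 = 0` because `U(J)·(M₄ ∖ U(J)) ∩ U(J) = ∅`; the compact picture by ★ (G1-a)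
  `exists_carrier_of_rightFinite` on `u ↦ b (fr u)` with ★ (G1-b) `finiteDimensional_span_reading`).
* §2 corollaries: `exists_tubeSection_of_reading_apply` (the reading identity in the consumer's `T·g̃·T⁻¹` spelling is just `F (τ g) = b g` with `τ` the frame hom).
References: [LeeZhu1998, §5 p. 5032]; [Shimura1997, §§5–6, §16.4]; [BorelJacquet1979, §4.1]; [Knapp1986, Ch. VIII §3].
HONEST LABEL: HC_CM is proved only modulo the 7 printed citations (2 remaining named inputs: hLiu418 = stmt-HodgeConjecture-24832,
h413 = stmt-HodgeConjecture-24833) until rung 0 closes; count-neutral helper, closes no socket.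
-/

set_option autoImplicit false
set_option linter.dupNamespace false

noncomputable section

open scoped Matrix ComplexConjugate
open Complex Matrix

namespace Summit.HodgeConjecture.HodgeConjecture.Cruxes.HLiu418.K2LiuArchOnePlaceTubeSection

open K2LiuU22CompactPictureDefs K2LiuArchInducedTubeDefs
open K2LiuU22CarrierOfFiniteFunction (exists_carrier_of_rightFinite)
open K2LiuArchMultiPlaceCompactPicture (finiteDimensional_span_reading)

variable {G : Type*} [Group G] [TopologicalSpace G]

/-- **A ONE-PLACE SECTION READ THROUGH A TUBE FRAME IS A TUBE SIEGEL SECTION WITH A COMPACT PICTURE.**  `τ : G →* M₄(ℂ)` injective with image containing `U(J)` (no membership clause is needed: the law off the image is `0 = 0`);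
`fr : U(2) →* G` continuous with `τ (fr u) = κ(1, u)` (the Cayley point); `b : G → ℂ` continuous, right-`fr`-finite inside a finite-dimensional `S`, and Siegel in tube
letters.  Then `∃ F Q`: `F ∈ I_w(s, χ)` (★ `IsArchSiegelSection χ s F`), `cp F = Q` (`F(κ(1,v)) = ev_v Q` for unitary `v`, ★ FILE 9 ∕ ★ (E8) END bytes), and `F ∘ τ = b`.
[LeeZhu1998, §5 p. 5032] [Shimura1997, §16.4] [BorelJacquet1979, §4.1] -/
theorem exists_tubeSection_of_reading (τ : G →* Matrix (Fin 2 ⊕ Fin 2) (Fin 2 ⊕ Fin 2) ℂ) (hτinj : Function.Injective τ)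
    (hτsurj : ∀ P : Matrix (Fin 2 ⊕ Fin 2) (Fin 2 ⊕ Fin 2) ℂ, Pᴴ * Matrix.J (Fin 2) ℂ * P = Matrix.J (Fin 2) ℂ → ∃ g, τ g = P)
    (fr : Matrix.unitaryGroup (Fin 2) ℂ →* G) (hfrc : Continuous fr)
    (hfrτ : ∀ u : Matrix.unitaryGroup (Fin 2) ℂ, τ (fr u) =
      (2 : ℂ)⁻¹ • fromBlocks (1 + (u : Matrix (Fin 2) (Fin 2) ℂ)) (-(I • (1 - (u : Matrix (Fin 2) (Fin 2) ℂ)))) (I • (1 - (u : Matrix (Fin 2) (Fin 2) ℂ))) (1 + (u : Matrix (Fin 2) (Fin 2) ℂ)))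
    (χ : ℂ → ℂ) (s : ℂ) (b : G → ℂ) (hbc : Continuous b)
    (hlaw : ∀ p g : G, (τ p).toBlocks₂₁ = 0 →
      b (p * g) = χ (τ p).toBlocks₁₁.det * (((‖(τ p).toBlocks₁₁.det‖ : ℝ) : ℂ) ^ (2 * s + (Fintype.card (Fin 2) : ℂ))) * b g)
    (S : Submodule ℂ (G → ℂ)) [FiniteDimensional ℂ S] (hbS : b ∈ S) (hS : ∀ f ∈ S, ∀ u : Matrix.unitaryGroup (Fin 2) ℂ, (fun x => f (x * fr u)) ∈ S) :
    ∃ (F : Matrix (Fin 2 ⊕ Fin 2) (Fin 2 ⊕ Fin 2) ℂ → ℂ) (Q : Carrier), IsArchSiegelSection χ s F ∧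
      (∀ (v : Matrix (Fin 2) (Fin 2) ℂ), vᴴ * v = 1 → ∀ hv : v.det ≠ 0,
        F ((2 : ℂ)⁻¹ • fromBlocks (1 + v) (-(I • (1 - v))) (I • (1 - v)) (1 + v) : Matrix (Fin 2 ⊕ Fin 2) (Fin 2 ⊕ Fin 2) ℂ) = evalAt v hv Q) ∧
      ∀ g, F (τ g) = b g := by
  classical
  -- the tube avatar: `b ∘ τ⁻¹` on the image `U(J)`, `0` elsewhere (kept opaque with its two values)
  obtain ⟨F, hFτ, hF0⟩ : ∃ F : Matrix (Fin 2 ⊕ Fin 2) (Fin 2 ⊕ Fin 2) ℂ → ℂ, (∀ g, F (τ g) = b g) ∧ ∀ P, (¬ ∃ g, τ g = P) → F P = 0 := by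
    refine ⟨fun P => if h : ∃ g, τ g = P then b h.choose else 0, fun g => ?_, fun P hP => dif_neg hP⟩
    have h : ∃ g', τ g' = τ g := ⟨g, rfl⟩
    simp only [dif_pos h]
    exact congrArg b (hτinj h.choose_spec)
  -- the compact picture: `u ↦ b (fr u)` is continuous and right-`U(2)`-finite
  have hfin := finiteDimensional_span_reading S (Set.range fr) (fun f hf k ⟨u, hu⟩ => hu ▸ hS f hf u) fr (fun u => ⟨u, rfl⟩) hbS
  obtain ⟨Q, hQ⟩ := exists_carrier_of_rightFinite (fun u => b (fr u)) (hbc.comp hfrc) hfin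
  refine ⟨F, Q, fun p g hP hp => ?_, fun v hv hdet => ?_, hFτ⟩
  · -- the Siegel law at `s`
    obtain ⟨p₀, rfl⟩ := hτsurj p hP
    by_cases hg : ∃ g₀, τ g₀ = g
    · obtain ⟨g₀, rfl⟩ := hg
      rw [← map_mul, hFτ, hFτ, hlaw p₀ g₀ hp]
    · -- off the image both sides vanish: `τ p₀ · g ∈ τ(G)` would force `g = τ(p₀⁻¹ g₁) ∈ τ(G)`
      have hpg : ¬ ∃ g₁, τ g₁ = τ p₀ * g := by
        rintro ⟨g₁, hg₁⟩
        refine hg ⟨p₀⁻¹ * g₁, ?_⟩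
        rw [map_mul, hg₁, ← mul_assoc, ← map_mul, inv_mul_cancel, map_one, Matrix.one_mul]
      rw [hF0 _ hpg, hF0 _ hg, mul_zero]
  · -- the compact picture at the Cayley point of a unitary `v`
    have hmem : v ∈ Matrix.unitaryGroup (Fin 2) ℂ := Matrix.mem_unitaryGroup_iff'.2 hv
    have h := hQ ⟨v, hmem⟩
    rw [← hFτ (fr ⟨v, hmem⟩), hfrτ] at h
    exact h

/-- **the same with the frame spelled `τ g = T · g̃ · T⁻¹` on underlying matrices** (consumer form): if `τ` agrees with a matrix formula `φ` on `G`, the reading identity reads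
`F (φ g) = b g`. [Shimura1997, §§5–6] -/
theorem exists_tubeSection_of_reading' (τ : G →* Matrix (Fin 2 ⊕ Fin 2) (Fin 2 ⊕ Fin 2) ℂ) (hτinj : Function.Injective τ)
    (hτsurj : ∀ P : Matrix (Fin 2 ⊕ Fin 2) (Fin 2 ⊕ Fin 2) ℂ, Pᴴ * Matrix.J (Fin 2) ℂ * P = Matrix.J (Fin 2) ℂ → ∃ g, τ g = P)
    (φ : G → Matrix (Fin 2 ⊕ Fin 2) (Fin 2 ⊕ Fin 2) ℂ) (hφ : ∀ g, τ g = φ g)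
    (fr : Matrix.unitaryGroup (Fin 2) ℂ →* G) (hfrc : Continuous fr)
    (hfrτ : ∀ u : Matrix.unitaryGroup (Fin 2) ℂ, φ (fr u) =
      (2 : ℂ)⁻¹ • fromBlocks (1 + (u : Matrix (Fin 2) (Fin 2) ℂ)) (-(I • (1 - (u : Matrix (Fin 2) (Fin 2) ℂ)))) (I • (1 - (u : Matrix (Fin 2) (Fin 2) ℂ))) (1 + (u : Matrix (Fin 2) (Fin 2) ℂ)))
    (χ : ℂ → ℂ) (s : ℂ) (b : G → ℂ) (hbc : Continuous b)
    (hlaw : ∀ p g : G, (φ p).toBlocks₂₁ = 0 →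
      b (p * g) = χ (φ p).toBlocks₁₁.det * (((‖(φ p).toBlocks₁₁.det‖ : ℝ) : ℂ) ^ (2 * s + (Fintype.card (Fin 2) : ℂ))) * b g)
    (S : Submodule ℂ (G → ℂ)) [FiniteDimensional ℂ S] (hbS : b ∈ S) (hS : ∀ f ∈ S, ∀ u : Matrix.unitaryGroup (Fin 2) ℂ, (fun x => f (x * fr u)) ∈ S) :
    ∃ (F : Matrix (Fin 2 ⊕ Fin 2) (Fin 2 ⊕ Fin 2) ℂ → ℂ) (Q : Carrier), IsArchSiegelSection χ s F ∧
      (∀ (v : Matrix (Fin 2) (Fin 2) ℂ), vᴴ * v = 1 → ∀ hv : v.det ≠ 0,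
        F ((2 : ℂ)⁻¹ • fromBlocks (1 + v) (-(I • (1 - v))) (I • (1 - v)) (1 + v) : Matrix (Fin 2 ⊕ Fin 2) (Fin 2 ⊕ Fin 2) ℂ) = evalAt v hv Q) ∧
      ∀ g, F (φ g) = b g := by
  have hφ' : (τ : G → Matrix (Fin 2 ⊕ Fin 2) (Fin 2 ⊕ Fin 2) ℂ) = φ := funext hφ
  subst hφ'
  exact exists_tubeSection_of_reading τ hτinj hτsurj fr hfrc hfrτ χ s b hbc hlaw S hbS hS

end Summit.HodgeConjecture.HodgeConjecture.Cruxes.HLiu418.K2LiuArchOnePlaceTubeSection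

end
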